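import Summits.Ventures.WeilGRH.DualTrigKernelFamily
import Summits.Ventures.WeilGRH.DualTrigFamilyValues
import Summits.Ventures.WeilGRH.DualTrigCertMod15OddLog7Half
import Summits.Ventures.WeilGRH.DualTrigCertMod16OddLog7Half
import Summits.Ventures.WeilGRH.DualTrigCertMod19OddLog7Half
import Summits.Ventures.WeilGRH.DualTrigCertMod11OddLog5Half
import Summits.Ventures.WeilGRH.DualTrigCertMod13OddLog5Half
import Summits.Ventures.WeilGRH.DualTrigCertMod16OddLog5Half
import Summits.Ventures.WeilGRH.DualTrigCertMod17EvenLog5Half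
import HarnessLib

/-!
# Format D-K: family forms (every modulus `q ≥ q₀`) of the landed per-modulus rungs (part 2/2)

Cell `rh-explicit`, WEIL TRACK — GRH ARM, route B (weil-grh-3).  Each landed format-D-K instance file proves
`cert_…_check : c.check = true` by `decide +kernel` and a rung for the characters of ONE modulus `c.q`.  By
`DKCert.weilPositivityOnChar_family_of_check` (`DualTrigKernelFamily.lean`) the SAME certificate proves the rung for
every modulus `q ≥ c.q` and every character with the listed parity and window values (and `χ(p) = 0` at the window
primes dividing `c.q`): the key-group family statements of the arm's A2 table, at zero additional kernel cost.

| theorem | q ≥ | parity | t | window values |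
|---|---|---|---|---|
| `weilPositivityOnChar_family_ge15_odd_chi2_one_log7half` | 15 | 1 | log 7 / 2 | χ(2) = 1, χ(3) = 0, χ(5) = 0 |
| `weilPositivityOnChar_family_ge16_odd_chi3_chi5_negI_log7half` | 16 | 1 | log 7 / 2 | χ(2) = 0, χ(3) = −i, χ(5) = −i |
| `weilPositivityOnChar_family_ge19_odd_real_log7half` | 19 | 1 | log 7 / 2 | χ(2) = −1, χ(3) = −1, χ(5) = 1 |
| `weilPositivityOnChar_family_ge11_odd_real_log5half` | 11 | 1 | log 5 / 2 | χ(2) = −1, χ(3) = 1 |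
| `weilPositivityOnChar_family_ge13_odd_chi2_negI_chi3_one_log5half` | 13 | 1 | log 5 / 2 | χ(2) = −i, χ(3) = 1 |
| `weilPositivityOnChar_family_ge16_odd_chi3_negI_log5half` | 16 | 1 | log 5 / 2 | χ(2) = 0, χ(3) = −i |
| `weilPositivityOnChar_family_ge17_even_chi2_neg_chi3_negI_log5half` | 17 | 0 | log 5 / 2 | χ(2) = −1, χ(3) = −i |

No named facts, no `sorry`, no kernel evaluation in this file; axioms standard.
-/

namespace Summit.Ventures.WeilGRH

open Literature.NumberTheory.LFunctions Literature.Analysis.ValidatedNumerics.NumericsMP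

/-- **Family form of `weilPositivityOnChar_mod15_odd_chi2_one_log7half`**: the same kernel certificate `cert_q15_odd_log7half` proves the rung `t = log 7 / 2` for
EVERY modulus `q ≥ 15` and every Dirichlet character `χ` mod `q` with parity 1 and χ(2) = 1, χ(3) = 0, χ(5) = 0
(`DKCert.weilPositivityOnChar_family_of_check`: the modulus enters the weight only through `+ log q`). [folklore] -/
theorem weilPositivityOnChar_family_ge15_odd_chi2_one_log7half {q : ℕ} (hq : 15 ≤ q) (χ : DirichletCharacter ℂ q) (hpar : charParity χ = 1) (hχ2 : χ 2 = 1) (hχ3 : χ 3 = 0) (hχ5 : χ 5 = 0) :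
    WeilPositivityOnChar χ (Real.log 7 / 2) := by
  have h := DKCert.weilPositivityOnChar_family_of_check cert_q15_odd_log7half_check hq (by omega) χ hpar ?_ ?_
  · have e : Real.log ((cert_q15_odd_log7half.N : ℝ) + 1) / 2 = Real.log 7 / 2 := by
      rw [show cert_q15_odd_log7half.N = 6 from rfl]; norm_num
    rw [e] at h
    exact h
  · intro val hval
    simp only [cert_q15_odd_log7half, List.mem_cons, List.mem_nil_iff, or_false] at hval
    rcases hval with rfl | rfl
    · change χ ((2 : ℕ) : ZMod q) = _
      rw [Nat.cast_ofNat, hχ2]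
      rw [DKCert.one_eq_expPhase]
      rw [DKCert.valZ_eq_expPhase, Complex.exp_eq_exp_iff_exists_int]
      exact ⟨0, by push_cast; ring⟩
    · change χ ((4 : ℕ) : ZMod q) = _
      rw [show ((4 : ℕ) : ZMod q) = (2 : ZMod q) ^ 2 by norm_num, map_pow, hχ2]
      rw [DKCert.one_eq_expPhase]
      rw [DKCert.valZ_eq_expPhase, ← Complex.exp_nat_mul, Complex.exp_eq_exp_iff_exists_int]
      exact ⟨0, by push_cast; ring⟩
  · intro n hn hpp hco
    rw [show cert_q15_odd_log7half.N = 6 from rfl] at hn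
    rw [show cert_q15_odd_log7half.q = 15 from rfl] at hco
    interval_cases n
    · exact absurd hpp not_isPrimePow_zero
    · exact absurd hpp not_isPrimePow_one
    · exact absurd (by decide : Nat.Coprime 2 15) hco
    · rw [Nat.cast_ofNat, hχ3]
    · exact absurd (by decide : Nat.Coprime 4 15) hco
    · rw [Nat.cast_ofNat, hχ5]
    · exact absurd hpp (by decide)

/-- **Family form of `weilPositivityOnChar_mod16_odd_chi3_chi5_negI_log7half`**: the same kernel certificate `cert_q16_odd_negi_log7half` proves the rung `t = log 7 / 2` for
EVERY modulus `q ≥ 16` and every Dirichlet character `χ` mod `q` with parity 1 and χ(2) = 0, χ(3) = −i, χ(5) = −i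
(`DKCert.weilPositivityOnChar_family_of_check`: the modulus enters the weight only through `+ log q`). [folklore] -/
theorem weilPositivityOnChar_family_ge16_odd_chi3_chi5_negI_log7half {q : ℕ} (hq : 16 ≤ q) (χ : DirichletCharacter ℂ q) (hpar : charParity χ = 1) (hχ2 : χ 2 = 0) (hχ3 : χ 3 = -Complex.I) (hχ5 : χ 5 = -Complex.I) :
    WeilPositivityOnChar χ (Real.log 7 / 2) := by
  have h := DKCert.weilPositivityOnChar_family_of_check cert_q16_odd_negi_log7half_check hq (by omega) χ hpar ?_ ?_
  · have e : Real.log ((cert_q16_odd_negi_log7half.N : ℝ) + 1) / 2 = Real.log 7 / 2 := by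
      rw [show cert_q16_odd_negi_log7half.N = 6 from rfl]; norm_num
    rw [e] at h
    exact h
  · intro val hval
    simp only [cert_q16_odd_negi_log7half, List.mem_cons, List.mem_nil_iff, or_false] at hval
    rcases hval with rfl | rfl
    · change χ ((3 : ℕ) : ZMod q) = _
      rw [Nat.cast_ofNat, hχ3]
      rw [DKCert.neg_I_eq_expPhase]
      rw [DKCert.valZ_eq_expPhase, Complex.exp_eq_exp_iff_exists_int]
      exact ⟨0, by push_cast; ring⟩
    · change χ ((5 : ℕ) : ZMod q) = _
      rw [Nat.cast_ofNat, hχ5]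
      rw [DKCert.neg_I_eq_expPhase]
      rw [DKCert.valZ_eq_expPhase, Complex.exp_eq_exp_iff_exists_int]
      exact ⟨0, by push_cast; ring⟩
  · intro n hn hpp hco
    rw [show cert_q16_odd_negi_log7half.N = 6 from rfl] at hn
    rw [show cert_q16_odd_negi_log7half.q = 16 from rfl] at hco
    interval_cases n
    · exact absurd hpp not_isPrimePow_zero
    · exact absurd hpp not_isPrimePow_one
    · rw [Nat.cast_ofNat, hχ2]
    · exact absurd (by decide : Nat.Coprime 3 16) hco
    · rw [show ((4 : ℕ) : ZMod q) = (2 : ZMod q) ^ 2 by norm_num, map_pow, hχ2]; simp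
    · exact absurd (by decide : Nat.Coprime 5 16) hco
    · exact absurd hpp (by decide)

/-- **Family form of `weilPositivityOnChar_mod19_odd_real_log7half`**: the same kernel certificate `cert_q19_odd_real_log7half` proves the rung `t = log 7 / 2` for
EVERY modulus `q ≥ 19` and every Dirichlet character `χ` mod `q` with parity 1 and χ(2) = −1, χ(3) = −1, χ(5) = 1
(`DKCert.weilPositivityOnChar_family_of_check`: the modulus enters the weight only through `+ log q`). [folklore] -/
theorem weilPositivityOnChar_family_ge19_odd_real_log7half {q : ℕ} (hq : 19 ≤ q) (χ : DirichletCharacter ℂ q) (hpar : charParity χ = 1) (hχ2 : χ 2 = -1) (hχ3 : χ 3 = -1) (hχ5 : χ 5 = 1) :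
    WeilPositivityOnChar χ (Real.log 7 / 2) := by
  have h := DKCert.weilPositivityOnChar_family_of_check cert_q19_odd_real_log7half_check hq (by omega) χ hpar ?_ ?_
  · have e : Real.log ((cert_q19_odd_real_log7half.N : ℝ) + 1) / 2 = Real.log 7 / 2 := by
      rw [show cert_q19_odd_real_log7half.N = 6 from rfl]; norm_num
    rw [e] at h
    exact h
  · intro val hval
    simp only [cert_q19_odd_real_log7half, List.mem_cons, List.mem_nil_iff, or_false] at hval
    rcases hval with rfl | rfl | rfl | rfl
    · change χ ((2 : ℕ) : ZMod q) = _
      rw [Nat.cast_ofNat, hχ2]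
      rw [DKCert.neg_one_eq_expPhase]
      rw [DKCert.valZ_eq_expPhase, Complex.exp_eq_exp_iff_exists_int]
      exact ⟨0, by push_cast; ring⟩
    · change χ ((3 : ℕ) : ZMod q) = _
      rw [Nat.cast_ofNat, hχ3]
      rw [DKCert.neg_one_eq_expPhase]
      rw [DKCert.valZ_eq_expPhase, Complex.exp_eq_exp_iff_exists_int]
      exact ⟨0, by push_cast; ring⟩
    · change χ ((4 : ℕ) : ZMod q) = _
      rw [show ((4 : ℕ) : ZMod q) = (2 : ZMod q) ^ 2 by norm_num, map_pow, hχ2]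
      rw [DKCert.neg_one_eq_expPhase]
      rw [DKCert.valZ_eq_expPhase, ← Complex.exp_nat_mul, Complex.exp_eq_exp_iff_exists_int]
      exact ⟨1, by push_cast; ring⟩
    · change χ ((5 : ℕ) : ZMod q) = _
      rw [Nat.cast_ofNat, hχ5]
      rw [DKCert.one_eq_expPhase]
      rw [DKCert.valZ_eq_expPhase, Complex.exp_eq_exp_iff_exists_int]
      exact ⟨0, by push_cast; ring⟩
  · exact DKCert.hχ0_of_coprime_window χ (by
      intro n h2 hn
      rw [show cert_q19_odd_real_log7half.N = 6 from rfl] at hn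
      rw [show cert_q19_odd_real_log7half.q = 19 from rfl]
      interval_cases n
      all_goals decide)

/-- **Family form of `weilPositivityOnChar_mod11_odd_real_log5half`**: the same kernel certificate `cert_q11_odd_real_log5half` proves the rung `t = log 5 / 2` for
EVERY modulus `q ≥ 11` and every Dirichlet character `χ` mod `q` with parity 1 and χ(2) = −1, χ(3) = 1
(`DKCert.weilPositivityOnChar_family_of_check`: the modulus enters the weight only through `+ log q`). [folklore] -/
theorem weilPositivityOnChar_family_ge11_odd_real_log5half {q : ℕ} (hq : 11 ≤ q) (χ : DirichletCharacter ℂ q) (hpar : charParity χ = 1) (hχ2 : χ 2 = -1) (hχ3 : χ 3 = 1) :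
    WeilPositivityOnChar χ (Real.log 5 / 2) := by
  have h := DKCert.weilPositivityOnChar_family_of_check cert_q11_odd_real_log5half_check hq (by omega) χ hpar ?_ ?_
  · have e : Real.log ((cert_q11_odd_real_log5half.N : ℝ) + 1) / 2 = Real.log 5 / 2 := by
      rw [show cert_q11_odd_real_log5half.N = 4 from rfl]; norm_num
    rw [e] at h
    exact h
  · intro val hval
    simp only [cert_q11_odd_real_log5half, List.mem_cons, List.mem_nil_iff, or_false] at hval
    rcases hval with rfl | rfl | rfl
    · change χ ((2 : ℕ) : ZMod q) = _
      rw [Nat.cast_ofNat, hχ2]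
      rw [DKCert.neg_one_eq_expPhase]
      rw [DKCert.valZ_eq_expPhase, Complex.exp_eq_exp_iff_exists_int]
      exact ⟨0, by push_cast; ring⟩
    · change χ ((3 : ℕ) : ZMod q) = _
      rw [Nat.cast_ofNat, hχ3]
      rw [DKCert.one_eq_expPhase]
      rw [DKCert.valZ_eq_expPhase, Complex.exp_eq_exp_iff_exists_int]
      exact ⟨0, by push_cast; ring⟩
    · change χ ((4 : ℕ) : ZMod q) = _
      rw [show ((4 : ℕ) : ZMod q) = (2 : ZMod q) ^ 2 by norm_num, map_pow, hχ2]
      rw [DKCert.neg_one_eq_expPhase]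
      rw [DKCert.valZ_eq_expPhase, ← Complex.exp_nat_mul, Complex.exp_eq_exp_iff_exists_int]
      exact ⟨1, by push_cast; ring⟩
  · exact DKCert.hχ0_of_coprime_window χ (by
      intro n h2 hn
      rw [show cert_q11_odd_real_log5half.N = 4 from rfl] at hn
      rw [show cert_q11_odd_real_log5half.q = 11 from rfl]
      interval_cases n
      all_goals decide)

/-- **Family form of `weilPositivityOnChar_mod13_odd_chi2_negI_chi3_one_log5half`**: the same kernel certificate `cert_q13_odd_negi_log5half` proves the rung `t = log 5 / 2` for
EVERY modulus `q ≥ 13` and every Dirichlet character `χ` mod `q` with parity 1 and χ(2) = −i, χ(3) = 1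
(`DKCert.weilPositivityOnChar_family_of_check`: the modulus enters the weight only through `+ log q`). [folklore] -/
theorem weilPositivityOnChar_family_ge13_odd_chi2_negI_chi3_one_log5half {q : ℕ} (hq : 13 ≤ q) (χ : DirichletCharacter ℂ q) (hpar : charParity χ = 1) (hχ2 : χ 2 = -Complex.I) (hχ3 : χ 3 = 1) :
    WeilPositivityOnChar χ (Real.log 5 / 2) := by
  have h := DKCert.weilPositivityOnChar_family_of_check cert_q13_odd_negi_log5half_check hq (by omega) χ hpar ?_ ?_
  · have e : Real.log ((cert_q13_odd_negi_log5half.N : ℝ) + 1) / 2 = Real.log 5 / 2 := by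
      rw [show cert_q13_odd_negi_log5half.N = 4 from rfl]; norm_num
    rw [e] at h
    exact h
  · intro val hval
    simp only [cert_q13_odd_negi_log5half, List.mem_cons, List.mem_nil_iff, or_false] at hval
    rcases hval with rfl | rfl | rfl
    · change χ ((2 : ℕ) : ZMod q) = _
      rw [Nat.cast_ofNat, hχ2]
      rw [DKCert.neg_I_eq_expPhase]
      rw [DKCert.valZ_eq_expPhase, Complex.exp_eq_exp_iff_exists_int]
      exact ⟨0, by push_cast; ring⟩
    · change χ ((3 : ℕ) : ZMod q) = _
      rw [Nat.cast_ofNat, hχ3]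
      rw [DKCert.one_eq_expPhase]
      rw [DKCert.valZ_eq_expPhase, Complex.exp_eq_exp_iff_exists_int]
      exact ⟨0, by push_cast; ring⟩
    · change χ ((4 : ℕ) : ZMod q) = _
      rw [show ((4 : ℕ) : ZMod q) = (2 : ZMod q) ^ 2 by norm_num, map_pow, hχ2]
      rw [DKCert.neg_I_eq_expPhase]
      rw [DKCert.valZ_eq_expPhase, ← Complex.exp_nat_mul, Complex.exp_eq_exp_iff_exists_int]
      exact ⟨-1, by push_cast; ring⟩
  · exact DKCert.hχ0_of_coprime_window χ (by
      intro n h2 hn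
      rw [show cert_q13_odd_negi_log5half.N = 4 from rfl] at hn
      rw [show cert_q13_odd_negi_log5half.q = 13 from rfl]
      interval_cases n
      all_goals decide)

/-- **Family form of `weilPositivityOnChar_mod16_odd_chi3_negI_log5half`**: the same kernel certificate `cert_q16_odd_negi_log5half` proves the rung `t = log 5 / 2` for
EVERY modulus `q ≥ 16` and every Dirichlet character `χ` mod `q` with parity 1 and χ(2) = 0, χ(3) = −i
(`DKCert.weilPositivityOnChar_family_of_check`: the modulus enters the weight only through `+ log q`). [folklore] -/
theorem weilPositivityOnChar_family_ge16_odd_chi3_negI_log5half {q : ℕ} (hq : 16 ≤ q) (χ : DirichletCharacter ℂ q) (hpar : charParity χ = 1) (hχ2 : χ 2 = 0) (hχ3 : χ 3 = -Complex.I) :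
    WeilPositivityOnChar χ (Real.log 5 / 2) := by
  have h := DKCert.weilPositivityOnChar_family_of_check cert_q16_odd_negi_log5half_check hq (by omega) χ hpar ?_ ?_
  · have e : Real.log ((cert_q16_odd_negi_log5half.N : ℝ) + 1) / 2 = Real.log 5 / 2 := by
      rw [show cert_q16_odd_negi_log5half.N = 4 from rfl]; norm_num
    rw [e] at h
    exact h
  · intro val hval
    simp only [cert_q16_odd_negi_log5half, List.mem_singleton] at hval
    subst hval
    change χ ((3 : ℕ) : ZMod q) = _
    rw [Nat.cast_ofNat, hχ3]
    rw [DKCert.neg_I_eq_expPhase]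
    rw [DKCert.valZ_eq_expPhase, Complex.exp_eq_exp_iff_exists_int]
    exact ⟨0, by push_cast; ring⟩
  · intro n hn hpp hco
    rw [show cert_q16_odd_negi_log5half.N = 4 from rfl] at hn
    rw [show cert_q16_odd_negi_log5half.q = 16 from rfl] at hco
    interval_cases n
    · exact absurd hpp not_isPrimePow_zero
    · exact absurd hpp not_isPrimePow_one
    · rw [Nat.cast_ofNat, hχ2]
    · exact absurd (by decide : Nat.Coprime 3 16) hco
    · rw [show ((4 : ℕ) : ZMod q) = (2 : ZMod q) ^ 2 by norm_num, map_pow, hχ2]; simp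

/-- **Family form of `weilPositivityOnChar_mod17_even_chi2_neg_chi3_negI_log5half`**: the same kernel certificate `cert_q17_even_negi_log5half` proves the rung `t = log 5 / 2` for
EVERY modulus `q ≥ 17` and every Dirichlet character `χ` mod `q` with parity 0 and χ(2) = −1, χ(3) = −i
(`DKCert.weilPositivityOnChar_family_of_check`: the modulus enters the weight only through `+ log q`). [folklore] -/
theorem weilPositivityOnChar_family_ge17_even_chi2_neg_chi3_negI_log5half {q : ℕ} (hq : 17 ≤ q) (χ : DirichletCharacter ℂ q) (hpar : charParity χ = 0) (hχ2 : χ 2 = -1) (hχ3 : χ 3 = -Complex.I) :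
    WeilPositivityOnChar χ (Real.log 5 / 2) := by
  have h := DKCert.weilPositivityOnChar_family_of_check cert_q17_even_negi_log5half_check hq (by omega) χ hpar ?_ ?_
  · have e : Real.log ((cert_q17_even_negi_log5half.N : ℝ) + 1) / 2 = Real.log 5 / 2 := by
      rw [show cert_q17_even_negi_log5half.N = 4 from rfl]; norm_num
    rw [e] at h
    exact h
  · intro val hval
    simp only [cert_q17_even_negi_log5half, List.mem_cons, List.mem_nil_iff, or_false] at hval
    rcases hval with rfl | rfl | rfl
    · change χ ((2 : ℕ) : ZMod q) = _
      rw [Nat.cast_ofNat, hχ2]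
      rw [DKCert.neg_one_eq_expPhase]
      rw [DKCert.valZ_eq_expPhase, Complex.exp_eq_exp_iff_exists_int]
      exact ⟨0, by push_cast; ring⟩
    · change χ ((3 : ℕ) : ZMod q) = _
      rw [Nat.cast_ofNat, hχ3]
      rw [DKCert.neg_I_eq_expPhase]
      rw [DKCert.valZ_eq_expPhase, Complex.exp_eq_exp_iff_exists_int]
      exact ⟨0, by push_cast; ring⟩
    · change χ ((4 : ℕ) : ZMod q) = _
      rw [show ((4 : ℕ) : ZMod q) = (2 : ZMod q) ^ 2 by norm_num, map_pow, hχ2]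
      rw [DKCert.neg_one_eq_expPhase]
      rw [DKCert.valZ_eq_expPhase, ← Complex.exp_nat_mul, Complex.exp_eq_exp_iff_exists_int]
      exact ⟨1, by push_cast; ring⟩
  · exact DKCert.hχ0_of_coprime_window χ (by
      intro n h2 hn
      rw [show cert_q17_even_negi_log5half.N = 4 from rfl] at hn
      rw [show cert_q17_even_negi_log5half.q = 17 from rfl]
      interval_cases n
      all_goals decide)

end Summit.Ventures.WeilGRH
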